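import Summits.QuantumFields.YangMills.Theorems.FluctuationComparisonRegPrIntLS2BetaTaylorOfLocal
import HarnessLib

/-!
# S2β · «THE FIBRE EDITION OF THE PREFIX DOOR»: LOC‴ (= LOC″ + the datum-guard binder `G F J (descendTo U₀)` + the fibre-mate binder `descendTo (expPoint ζ • U₀) = descendTo U₀`) + the (BKG) tower letter ⟹ TAYLOR‴ ⟹
# AVG₂♭-ax_q VERBATIM — the binder is DISCHARGED where the letters are used: `hM`'s partner `U ∈ fibre` and the minimiser `U₀ ∈ fibre` both descend to `V`

Cell `ym3-torus` (YM ladder rung R3 = continuum `SU(2)` Yang–Mills on the three-torus at fixed lattice data — a RUNG: NOT d = 4, NOT infinite volume, NOT a mass gap,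
NOT Clay).  Width seat «width 16» `ym3-torus-px16` (gen 23), S2β pairing-letter lane holder; crux `stmt-QuantumFields-20520`, LINE g18-1 S2β.
`--kind proof --supports stmt-QuantumFields-20520 --as helper`, count-neutral, DEFINITION-FREE (0 `def`, 0 `instance`, 0 `notation`, 0 `sorry`); ONE decl-local
`set_option maxHeartbeats 400000 in` on `taylor_of_local‴` (as on ✓p828403 `taylor_of_local` and ✓p831986 `taylor_of_local''`: the same prefix elaboration).

WHY (ARCHITECT RULING px17 g22 2026-08-31T20:10Z «FIBRE EDITION OF THE LETTERS», px16 g23 «JNC-0»).  The chart road of the sup chain ((β-3)′, the comb∕face rows' arcs `≤ ¼`, the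
arc profile ✓p832020, the level-0 junction) is a SMALL-CHORD road; fibre-free, LOC″'s partner `expPoint ζ • U₀` has `O(1)` top chords.  At the point of use the partner IS a fibre
mate (`hM` quantifies `∀ U ∈ fibre F ℰp J K hJK V`), so the letters LOC‴ ∕ (ST‴) ∕ LIFT-LADDER⁵ carry ONE more binder — `descendTo F ℰp J K hJK (expPoint ζ • U₀) = descendTo F ℰp J K hJK U₀ →`
right after the partner's `∈ histGood … →`, and (px17 g22 FILE 2‴ d45c9918) the DATUM-GUARD binder `G F J (descendTo F ℰp J K hJK U₀) →` right after `U₀ ∈ histGood … →` — and THIS FILE discharges both (the guard from `hG : G F J V` and `U₀ ∈ fibre V`): ✓p831986's two theorems re-threaded with the binder, and ✓`avg2_of_taylor` (Q6) re-run with the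
one-line discharge `fibre V = {U | descendTo … U = V}` (lit `T3ConstrainedMinimiser.fibre`) at `U` and `U₀`, after `expPoint (logVec chord) • U₀ = U` (✓`expPoint_logChord_mul`).

WHAT IS PROVED (sorry-free).  ★★★ `avg2_of_taylor‴ (G) (Ax) (hT‴)` : AVG₂♭-ax_q VERBATIM from TAYLOR‴; ★★★ `taylor_of_local‴ (G) (Ax) (hBkgT) (hLoc‴)` : TAYLOR‴ (= TAYLOR♭_q + the
binder); ★★★ `avg2_of_local‴ (G) (Ax) (hBkgT) (hLoc‴)` : AVG₂♭-ax_q VERBATIM.  With the census knit: GAP♯∘ ⟸ {h3, (D-stage)×2, (ST‴)} once FILE 2‴ (`loc_of_supTowerLetter‴`) lands.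

HONEST SCOPE.  Prefix plumbing; LOC‴ and every ladder letter are HYPOTHESES; nothing of Bałaban's analysis is asserted or proved ([Balaban1985Averaging] Prop. 3 (123) p.36,
(148)–(149) p.40; [Balaban1985Variational] (R1); [Balaban1985UV3] (7) p.257); GAP♯∘ (`stub_uniformFibreGapOrbit`, registry untouched, 0∕5), S2β, crux 20520, 19936, 19200 and
`YM3TorusSU2` are NOT proved; no registered stub is closed; rung R3 = SU(2) YM₃ on T³ — NOT d = 4, NOT infinite volume, NOT a mass gap, NOT Clay; the Yang–Mills mass gap is NOT proved.
-/

set_option autoImplicit false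

noncomputable section

open scoped Matrix.Norms.L2Operator Topology Quaternion
open Filter Set Function Finset
open Literature.MathematicalPhysics.QuantumLattice (su2Quat)
open Literature.MathematicalPhysics.QuantumFieldTheory.Balaban1983to89
open Literature.MathematicalPhysics.QuantumFieldTheory.Balaban1983to89.ExpMeanLog (expMeanLogSU deltaSU deltaSU_pos)
open Literature.MathematicalPhysics.QuantumFieldTheory.Balaban1983to89.T3ContinuumYM3Torus
open Literature.MathematicalPhysics.QuantumFieldTheory.Balaban1983to89.T3UnitLawDensityEML (ℰp)
open Literature.MathematicalPhysics.QuantumFieldTheory.Balaban1983to89.T3UnitScaleTilt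
open Literature.MathematicalPhysics.QuantumFieldTheory.Balaban1983to89.T3TiltDescent
open Literature.MathematicalPhysics.QuantumFieldTheory.Balaban1983to89.T3ConstrainedMinimiser (fibre)
open Literature.MathematicalPhysics.QuantumFieldTheory.Balaban1983to89.T3DescentFibreTower
open Literature.MathematicalPhysics.QuantumFieldTheory.Balaban1983to89.T3PrintedRegularMinimiser
open Literature.MathematicalPhysics.QuantumFieldTheory.Balaban1983to89.T3PrintedMinimiserExistence
open Literature.MathematicalPhysics.QuantumFieldTheory.Balaban1983to89.T3ThresholdSmallness (exists_forall_θBal_le)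
open Literature.MathematicalPhysics.QuantumFieldTheory.Balaban1983to89.T4HaarSU2ExpChart (expPoint)
open Literature.MathematicalPhysics.QuantumFieldTheory.Balaban1983to89.T4ExpWindowSmallField
open Literature.MathematicalPhysics.QuantumFieldTheory.Balaban1983to89.T4Continuum
open Summit.QuantumFields.YangMills.Theorems.FluctuationComparisonRegPrIntLS2BetaQuaternionReadFibreIdentity
  (avg2_of_taylor expPoint_logChord_mul norm_apply_chordField_eq_norm_taylorRem norm_logVec_sq_le)
open Summit.QuantumFields.YangMills.Theorems.FluctuationComparisonRegPrIntLS2BetaThresholdSum (thresholdSum_small)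
open Summit.QuantumFields.YangMills.Theorems.FluctuationComparisonRegPrIntLS2BetaCritMQuaternionReadWindow (prefixNumerics)

namespace Summit.QuantumFields.YangMills.Theorems.FluctuationComparisonRegPrIntLS2BetaTaylorOfLocalFib

/-- ★★★ **AVG₂♭-ax_q FROM TAYLOR‴ (fibre edition)**: as ✓`avg2_of_taylor`, the extra fibre-mate binder discharged from `U ∈ fibre` and `U₀ ∈ fibre` (both descend to `V`).
descent at an argmin good history is `≤ C_T·((L⁻¹)^{K−J}·Σ_ℓ‖ζ ℓ‖² + L^{K−J}·REL(expPoint ζ•U₀; U₀))` on `Ax`-admissible good histories `expPoint ζ • U₀`, `‖ζ ℓ‖ ≤ π`» — NO fibre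
condition (print's shape: [Balaban1985Averaging] (123), (148)–(149)).  On the fibre `Mq ζ̃ = 0` (§2), `‖ζ̃ ℓ‖² ≤ (π∕2)²·dist1²`, and the letter follows.
[cite: Balaban1985Averaging, Prop. 3 (123) p.36, (127)-(128) p.37, (148)-(149) p.40; Balaban1987RG1, (0.4) p.253, (0.21)-(0.22) p.256; Balaban1985Variational, Thm 1 (8)-(10) p.279] -/
theorem avg2_of_taylor'''
    (G : (F : T3Family) → (J : ℕ) → GaugeField (F.P J) 0 (Matrix.specialUnitaryGroup (Fin 2) ℂ) → Prop)
    (Ax : (F : T3Family) → (J K : ℕ) → (hJK : J ≤ K) → GaugeField (F.P K) 0 (Matrix.specialUnitaryGroup (Fin 2) ℂ) →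
      GaugeField (F.P K) 0 (Matrix.specialUnitaryGroup (Fin 2) ℂ) → Prop)
    (hT : ∀ (L : ℕ), ∃ c₀ : ℝ, 0 < c₀ ∧ c₀ ≤ 1 ∧ ∀ (cw : ℝ), 0 < cw → cw ≤ c₀ → ∃ pS : ℝ, ∀ (b₀ p₀ : ℝ), 0 < b₀ → pS ≤ p₀ → 0 < p₀ → ∃ ε₁ : ℝ, 0 < ε₁ ∧ ∀ (ε₀ : ℝ), 0 < ε₀ → ε₀ ≤ ε₁ →
    ∃ γ₁ : ℝ, 0 < γ₁ ∧ ∃ C_T : ℝ, 0 ≤ C_T ∧ ∀ (F : T3Family) (γ : ℝ), F.L = L → 0 < γ → γ ≤ γ₁ →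
      ∀ (J K : ℕ) (hJK : J ≤ K) (V : GaugeField (F.P J) 0 (Matrix.specialUnitaryGroup (Fin 2) ℂ)), PlaqSmall (θBal F.L γ (cw * b₀) p₀ J) V →
        G F J V →
        ∀ U₀ ∈ {U' : GaugeField (F.P K) 0 (Matrix.specialUnitaryGroup (Fin 2) ℂ) | U' ∈ fibre F ℰp J K hJK V ∧ U' ∈ histGood F ℰp (θBal F.L γ b₀ p₀) K J ∧
            wilsonAction4 U' = minActionRegPr F J K hJK ε₀ V},
        ∀ ζ : PBond (F.P K) 0 → EuclideanSpace ℝ (Fin 3), (∀ ℓ, ‖ζ ℓ‖ ≤ Real.pi) →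
          (fun ℓ => expPoint (ζ ℓ) * U₀ ℓ : GaugeField (F.P K) 0 (Matrix.specialUnitaryGroup (Fin 2) ℂ)) ∈ histGood F ℰp (θBal F.L γ b₀ p₀) K J →
          descendTo F ℰp J K hJK (fun ℓ => expPoint (ζ ℓ) * U₀ ℓ : GaugeField (F.P K) 0 (Matrix.specialUnitaryGroup (Fin 2) ℂ)) = descendTo F ℰp J K hJK U₀ →
            Ax F J K hJK (fun ℓ => expPoint (ζ ℓ) * U₀ ℓ) U₀ →
            ∑ B : PBond (F.P J) 0, ‖imVec (su2Quat (descendTo F ℰp J K hJK (fun ℓ => expPoint (ζ ℓ) * U₀ ℓ) B * (descendTo F ℰp J K hJK U₀ B)⁻¹)) -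
                (fderiv ℝ (fun (ζ : PBond (F.P K) 0 → EuclideanSpace ℝ (Fin 3)) (B : PBond (F.P J) 0) =>
                  imVec (su2Quat (descendTo F ℰp J K hJK (fun ℓ => expPoint (ζ ℓ) * U₀ ℓ) B * (descendTo F ℰp J K hJK U₀ B)⁻¹))) 0)
                  (fun ℓ => Real.sinc ‖ζ ℓ‖ • ζ ℓ) B‖ ≤
              C_T * (((F.L : ℝ)⁻¹) ^ (K - J) * ∑ ℓ : PBond (F.P K) 0, ‖ζ ℓ‖ ^ 2 +
                (F.L : ℝ) ^ (K - J) * ∑ p : Plaq (F.P K) 0,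
                  (1 - reTr ((GaugeField.plaqHol U₀ p)⁻¹ * GaugeField.plaqHol (fun ℓ => expPoint (ζ ℓ) * U₀ ℓ : GaugeField (F.P K) 0 (Matrix.specialUnitaryGroup (Fin 2) ℂ)) p)))) :
    ∀ (L : ℕ), ∃ c₀ : ℝ, 0 < c₀ ∧ c₀ ≤ 1 ∧ ∀ (cw : ℝ), 0 < cw → cw ≤ c₀ → ∃ pS : ℝ, ∀ (b₀ p₀ : ℝ), 0 < b₀ → pS ≤ p₀ → 0 < p₀ → ∃ ε₁ : ℝ, 0 < ε₁ ∧ ∀ (ε₀ : ℝ), 0 < ε₀ → ε₀ ≤ ε₁ →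
    ∃ γ₁ : ℝ, 0 < γ₁ ∧ ∃ C_M : ℝ, 0 ≤ C_M ∧ ∀ (F : T3Family) (γ : ℝ), F.L = L → 0 < γ → γ ≤ γ₁ →
      ∀ (J K : ℕ) (hJK : J ≤ K) (V : GaugeField (F.P J) 0 (Matrix.specialUnitaryGroup (Fin 2) ℂ)), PlaqSmall (θBal F.L γ (cw * b₀) p₀ J) V →
        G F J V →
        ∀ U₀ ∈ {U' : GaugeField (F.P K) 0 (Matrix.specialUnitaryGroup (Fin 2) ℂ) | U' ∈ fibre F ℰp J K hJK V ∧ U' ∈ histGood F ℰp (θBal F.L γ b₀ p₀) K J ∧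
            wilsonAction4 U' = minActionRegPr F J K hJK ε₀ V},
        ∀ U ∈ fibre F ℰp J K hJK V, U ∈ histGood F ℰp (θBal F.L γ b₀ p₀) K J →
            Ax F J K hJK U U₀ →
            ∑ B : PBond (F.P J) 0, ‖(fderiv ℝ (fun (ζ : PBond (F.P K) 0 → EuclideanSpace ℝ (Fin 3)) (B : PBond (F.P J) 0) =>
            imVec (su2Quat (descendTo F ℰp J K hJK (fun ℓ => expPoint (ζ ℓ) * U₀ ℓ) B * (descendTo F ℰp J K hJK U₀ B)⁻¹))) 0) (fun ℓ => imVec (su2Quat (U ℓ * (U₀ ℓ)⁻¹))) B‖ ≤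
              C_M * (((F.L : ℝ)⁻¹) ^ (K - J) * ∑ ℓ : PBond (F.P K) 0, dist1 (U ℓ * (U₀ ℓ)⁻¹) ^ 2 +
                (F.L : ℝ) ^ (K - J) * ∑ p : Plaq (F.P K) 0, (1 - reTr ((GaugeField.plaqHol U₀ p)⁻¹ * GaugeField.plaqHol U p))) := by
  intro L
  obtain ⟨c₀, hc₀, hc₀1, H⟩ := hT L
  refine ⟨c₀, hc₀, hc₀1, ?_⟩
  intro cw hcw hcwle
  obtain ⟨pS, H⟩ := H cw hcw hcwle
  refine ⟨pS, ?_⟩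
  intro b₀ p₀ hb hpS hp
  obtain ⟨ε₁, hε₁, H⟩ := H b₀ p₀ hb hpS hp
  refine ⟨ε₁, hε₁, ?_⟩
  intro ε₀ hε₀ hε₀le
  obtain ⟨γ₁, hγ₁, C_T, hCT, H⟩ := H ε₀ hε₀ hε₀le
  refine ⟨γ₁, hγ₁, (Real.pi / 2) ^ 2 * C_T, by positivity, ?_⟩
  intro F γ hFL hγ hγle J K hJK V hV hG U₀ hU₀ U hU hUg hAx
  -- the exact coordinates of `U` over `U₀`
  set ζ : PBond (F.P K) 0 → EuclideanSpace ℝ (Fin 3) := fun ℓ => logVec (su2Quat (U ℓ * (U₀ ℓ)⁻¹)) with hζdef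
  have hUζ : (fun ℓ => expPoint (ζ ℓ) * U₀ ℓ : GaugeField (F.P K) 0 (Matrix.specialUnitaryGroup (Fin 2) ℂ)) = U := expPoint_logChord_mul U U₀
  have hπ : ∀ ℓ, ‖ζ ℓ‖ ≤ Real.pi := fun ℓ => norm_logVec_le_pi _
  have hUg' : (fun ℓ => expPoint (ζ ℓ) * U₀ ℓ : GaugeField (F.P K) 0 (Matrix.specialUnitaryGroup (Fin 2) ℂ)) ∈
      histGood F ℰp (θBal F.L γ b₀ p₀) K J := by rw [hUζ]; exact hUg
  have hAx' : Ax F J K hJK (fun ℓ => expPoint (ζ ℓ) * U₀ ℓ) U₀ := by rw [hUζ]; exact hAx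
  have hFib' : descendTo F ℰp J K hJK (fun ℓ => expPoint (ζ ℓ) * U₀ ℓ : GaugeField (F.P K) 0 (Matrix.specialUnitaryGroup (Fin 2) ℂ)) =
      descendTo F ℰp J K hJK U₀ := by
    rw [hUζ]
    exact (show descendTo F ℰp J K hJK U = V from hU).trans (show descendTo F ℰp J K hJK U₀ = V from hU₀.1).symm
  have key := H F γ hFL hγ hγle J K hJK V hV hG U₀ hU₀ ζ hπ hUg' hFib' hAx'
  -- the left-hand sides agree term by term (fibre identity in the letter's currency)
  have hLHS : ∀ B : PBond (F.P J) 0,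
      ‖(fderiv ℝ (fun (ζ : PBond (F.P K) 0 → EuclideanSpace ℝ (Fin 3)) (B : PBond (F.P J) 0) =>
          imVec (su2Quat (descendTo F ℰp J K hJK (fun ℓ => expPoint (ζ ℓ) * U₀ ℓ) B * (descendTo F ℰp J K hJK U₀ B)⁻¹))) 0)
          (fun ℓ => imVec (su2Quat (U ℓ * (U₀ ℓ)⁻¹))) B‖ =
      ‖imVec (su2Quat (descendTo F ℰp J K hJK (fun ℓ => expPoint (ζ ℓ) * U₀ ℓ) B * (descendTo F ℰp J K hJK U₀ B)⁻¹)) -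
        (fderiv ℝ (fun (ζ : PBond (F.P K) 0 → EuclideanSpace ℝ (Fin 3)) (B : PBond (F.P J) 0) =>
          imVec (su2Quat (descendTo F ℰp J K hJK (fun ℓ => expPoint (ζ ℓ) * U₀ ℓ) B * (descendTo F ℰp J K hJK U₀ B)⁻¹))) 0)
          (fun ℓ => Real.sinc ‖ζ ℓ‖ • ζ ℓ) B‖ :=
    fun B => norm_apply_chordField_eq_norm_taylorRem hJK hU₀.1 hU _ B
  -- the right-hand sides: `‖ζ̃ ℓ‖² ≤ (π/2)²·dist1²`, the REL term is literally the same after `expPoint ζ̃ • U₀ = U`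
  have hN : (0 : ℝ) ≤ ((F.L : ℝ)⁻¹) ^ (K - J) := by positivity
  have hN' : (0 : ℝ) ≤ (F.L : ℝ) ^ (K - J) := by positivity
  have hd2 : ∑ ℓ : PBond (F.P K) 0, ‖ζ ℓ‖ ^ 2 ≤ (Real.pi / 2) ^ 2 * ∑ ℓ : PBond (F.P K) 0, dist1 (U ℓ * (U₀ ℓ)⁻¹) ^ 2 := by
    rw [Finset.mul_sum]
    exact Finset.sum_le_sum fun ℓ _ => norm_logVec_sq_le (U ℓ * (U₀ ℓ)⁻¹)
  have hREL : ∑ p : Plaq (F.P K) 0, (1 - reTr ((GaugeField.plaqHol U₀ p)⁻¹ *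
      GaugeField.plaqHol (fun ℓ => expPoint (ζ ℓ) * U₀ ℓ : GaugeField (F.P K) 0 (Matrix.specialUnitaryGroup (Fin 2) ℂ)) p)) =
      ∑ p : Plaq (F.P K) 0, (1 - reTr ((GaugeField.plaqHol U₀ p)⁻¹ * GaugeField.plaqHol U p)) := by rw [hUζ]
  have hRELnn : 0 ≤ ∑ p : Plaq (F.P K) 0, (1 - reTr ((GaugeField.plaqHol U₀ p)⁻¹ * GaugeField.plaqHol U p)) :=
    Finset.sum_nonneg fun p _ => sub_nonneg.2 (GaugeGroup.reTr_le_one _)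
  have hπ1 : (1 : ℝ) ≤ (Real.pi / 2) ^ 2 := by nlinarith [Real.pi_gt_three]
  calc ∑ B : PBond (F.P J) 0, ‖(fderiv ℝ (fun (ζ : PBond (F.P K) 0 → EuclideanSpace ℝ (Fin 3)) (B : PBond (F.P J) 0) =>
            imVec (su2Quat (descendTo F ℰp J K hJK (fun ℓ => expPoint (ζ ℓ) * U₀ ℓ) B * (descendTo F ℰp J K hJK U₀ B)⁻¹))) 0)
            (fun ℓ => imVec (su2Quat (U ℓ * (U₀ ℓ)⁻¹))) B‖
      = ∑ B : PBond (F.P J) 0, ‖imVec (su2Quat (descendTo F ℰp J K hJK (fun ℓ => expPoint (ζ ℓ) * U₀ ℓ) B * (descendTo F ℰp J K hJK U₀ B)⁻¹)) -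
          (fderiv ℝ (fun (ζ : PBond (F.P K) 0 → EuclideanSpace ℝ (Fin 3)) (B : PBond (F.P J) 0) =>
            imVec (su2Quat (descendTo F ℰp J K hJK (fun ℓ => expPoint (ζ ℓ) * U₀ ℓ) B * (descendTo F ℰp J K hJK U₀ B)⁻¹))) 0)
            (fun ℓ => Real.sinc ‖ζ ℓ‖ • ζ ℓ) B‖ := Finset.sum_congr rfl fun B _ => hLHS B
    _ ≤ C_T * (((F.L : ℝ)⁻¹) ^ (K - J) * ∑ ℓ : PBond (F.P K) 0, ‖ζ ℓ‖ ^ 2 +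
          (F.L : ℝ) ^ (K - J) * ∑ p : Plaq (F.P K) 0, (1 - reTr ((GaugeField.plaqHol U₀ p)⁻¹ * GaugeField.plaqHol U p))) := by rw [← hREL]; exact key
    _ ≤ (Real.pi / 2) ^ 2 * C_T * (((F.L : ℝ)⁻¹) ^ (K - J) * ∑ ℓ : PBond (F.P K) 0, dist1 (U ℓ * (U₀ ℓ)⁻¹) ^ 2 +
          (F.L : ℝ) ^ (K - J) * ∑ p : Plaq (F.P K) 0, (1 - reTr ((GaugeField.plaqHol U₀ p)⁻¹ * GaugeField.plaqHol U p))) := by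
        have h1 : ((F.L : ℝ)⁻¹) ^ (K - J) * ∑ ℓ : PBond (F.P K) 0, ‖ζ ℓ‖ ^ 2 ≤
            (Real.pi / 2) ^ 2 * (((F.L : ℝ)⁻¹) ^ (K - J) * ∑ ℓ : PBond (F.P K) 0, dist1 (U ℓ * (U₀ ℓ)⁻¹) ^ 2) := by
          rw [mul_left_comm]; exact mul_le_mul_of_nonneg_left hd2 hN
        have h2 : (F.L : ℝ) ^ (K - J) * ∑ p : Plaq (F.P K) 0, (1 - reTr ((GaugeField.plaqHol U₀ p)⁻¹ * GaugeField.plaqHol U p)) ≤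
            (Real.pi / 2) ^ 2 * ((F.L : ℝ) ^ (K - J) * ∑ p : Plaq (F.P K) 0, (1 - reTr ((GaugeField.plaqHol U₀ p)⁻¹ * GaugeField.plaqHol U p))) :=
          le_mul_of_one_le_left (mul_nonneg hN' hRELnn) hπ1
        calc C_T * (((F.L : ℝ)⁻¹) ^ (K - J) * ∑ ℓ : PBond (F.P K) 0, ‖ζ ℓ‖ ^ 2 +
              (F.L : ℝ) ^ (K - J) * ∑ p : Plaq (F.P K) 0, (1 - reTr ((GaugeField.plaqHol U₀ p)⁻¹ * GaugeField.plaqHol U p)))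
            ≤ C_T * ((Real.pi / 2) ^ 2 * (((F.L : ℝ)⁻¹) ^ (K - J) * ∑ ℓ : PBond (F.P K) 0, dist1 (U ℓ * (U₀ ℓ)⁻¹) ^ 2) +
              (Real.pi / 2) ^ 2 * ((F.L : ℝ) ^ (K - J) * ∑ p : Plaq (F.P K) 0, (1 - reTr ((GaugeField.plaqHol U₀ p)⁻¹ * GaugeField.plaqHol U p)))) :=
              mul_le_mul_of_nonneg_left (add_le_add h1 h2) hCT
          _ = _ := by ring


set_option maxHeartbeats 400000 in
/-- ★★★ **TAYLOR‴ (fibre edition) FROM LOC‴ AND THE (BKG) TOWER LETTER**: the prefix is threaded with the (BKG) letter's (`c₀, pS, ε₁, γ₁, C₁`), `C_B := C₁`, the window `α := min α_pN α₀`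
(✓`prefixNumerics` + ✓`exists_forall_θBal_le`), the (BKG) binder at the argmin from `hBkgT` with `θBal J ≤ α`, the history weight absorbed by ✓`thresholdSum_small`; `C_T′ := C_T·e^c`.
[cite: Balaban1985Averaging, Prop. 3 (123) p.36, Prop. 4 (128)-(135) pp.37-38, (148)-(149) p.40; Balaban1985Variational, (R1); Balaban1985UV3, (7) p.257; Balaban1987RG1, (0.4) p.253] -/
theorem taylor_of_local'''
    (G : (F : T3Family) → (J : ℕ) → GaugeField (F.P J) 0 (Matrix.specialUnitaryGroup (Fin 2) ℂ) → Prop)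
    (Ax : (F : T3Family) → (J K : ℕ) → (hJK : J ≤ K) → GaugeField (F.P K) 0 (Matrix.specialUnitaryGroup (Fin 2) ℂ) →
      GaugeField (F.P K) 0 (Matrix.specialUnitaryGroup (Fin 2) ℂ) → Prop)
    (hBkgT : ∀ (L : ℕ), ∃ c₀ : ℝ, 0 < c₀ ∧ c₀ ≤ 1 ∧ ∀ (cw : ℝ), 0 < cw → cw ≤ c₀ → ∃ pS : ℝ, ∀ (b₀ p₀ : ℝ), 0 < b₀ → pS ≤ p₀ → 0 < p₀ → ∃ ε₁ : ℝ, 0 < ε₁ ∧ ∀ (ε₀ : ℝ), 0 < ε₀ → ε₀ ≤ ε₁ →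
      ∃ γ₁ : ℝ, 0 < γ₁ ∧ ∃ C₁ : ℝ, 0 ≤ C₁ ∧ ∀ (F : T3Family) (γ : ℝ), F.L = L → 0 < γ → γ ≤ γ₁ →
        ∀ (J K : ℕ) (hJK : J ≤ K) (V : GaugeField (F.P J) 0 (Matrix.specialUnitaryGroup (Fin 2) ℂ)), PlaqSmall (θBal F.L γ (cw * b₀) p₀ J) V →
          G F J V →
          ∀ U₀ ∈ {U' : GaugeField (F.P K) 0 (Matrix.specialUnitaryGroup (Fin 2) ℂ) | U' ∈ fibre F ℰp J K hJK V ∧ U' ∈ histGood F ℰp (θBal F.L γ b₀ p₀) K J ∧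
              wilsonAction4 U' = minActionRegPr F J K hJK ε₀ V},
          ∀ t, t ≤ K - J → ∀ p : Plaq (F.P K) t,
            dist1 (GaugeField.plaqHol (Averaging.iter (fun k => BlockAveraging.blockAvg (P := F.P K) (j := k) ℰp) t U₀) p) ≤
              C₁ * θBal F.L γ b₀ p₀ J * (F.L : ℝ) ^ (2 * t) * ((F.L : ℝ)⁻¹) ^ (2 * (K - J)))
    (hLoc''' : ∀ (L : ℕ), 1 < L → ∀ (C_B : ℝ), 0 ≤ C_B → ∃ α₀ : ℝ, 0 < α₀ ∧ ∃ C_T : ℝ, 0 ≤ C_T ∧ ∃ c : ℝ, 0 ≤ c ∧ ∀ (F : T3Family), F.L = L →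
        ∀ (J K : ℕ) (hJK : J ≤ K) (θ : ℕ → ℝ), (∀ i, 0 ≤ θ i) → ∀ (α : ℝ), (∀ i, J < i → i ≤ K → (((5 * F.L : ℕ) : ℝ) ^ 2 / 4) * θ i ≤ α) →
          α ≤ 1 / 24 → α < deltaSU (Fin 2) → 157 * α < ((F.L : ℝ) ^ 2)⁻¹ → α ≤ α₀ →
          ∀ U₀ : GaugeField (F.P K) 0 (Matrix.specialUnitaryGroup (Fin 2) ℂ), U₀ ∈ histGood F ℰp θ K J →
          G F J (descendTo F ℰp J K hJK U₀) →
          (∀ t, t ≤ K - J → ∀ p : Plaq (F.P K) t,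
              dist1 (GaugeField.plaqHol (Averaging.iter (fun k => BlockAveraging.blockAvg (P := F.P K) (j := k) ℰp) t U₀) p) ≤
                C_B * α * (F.L : ℝ) ^ (2 * t) * ((F.L : ℝ)⁻¹) ^ (2 * (K - J))) →
          ∀ ζ : PBond (F.P K) 0 → EuclideanSpace ℝ (Fin 3), (∀ ℓ, ‖ζ ℓ‖ ≤ Real.pi) →
            (fun ℓ => expPoint (ζ ℓ) * U₀ ℓ : GaugeField (F.P K) 0 (Matrix.specialUnitaryGroup (Fin 2) ℂ)) ∈ histGood F ℰp θ K J →
            descendTo F ℰp J K hJK (fun ℓ => expPoint (ζ ℓ) * U₀ ℓ : GaugeField (F.P K) 0 (Matrix.specialUnitaryGroup (Fin 2) ℂ)) = descendTo F ℰp J K hJK U₀ →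
              Ax F J K hJK (fun ℓ => expPoint (ζ ℓ) * U₀ ℓ) U₀ →
              ∑ B : PBond (F.P J) 0, ‖imVec (su2Quat (descendTo F ℰp J K hJK (fun ℓ => expPoint (ζ ℓ) * U₀ ℓ) B * (descendTo F ℰp J K hJK U₀ B)⁻¹)) -
                  (fderiv ℝ (fun (ζ : PBond (F.P K) 0 → EuclideanSpace ℝ (Fin 3)) (B : PBond (F.P J) 0) =>
                    imVec (su2Quat (descendTo F ℰp J K hJK (fun ℓ => expPoint (ζ ℓ) * U₀ ℓ) B * (descendTo F ℰp J K hJK U₀ B)⁻¹))) 0)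
                    (fun ℓ => Real.sinc ‖ζ ℓ‖ • ζ ℓ) B‖ ≤
                C_T * Real.exp (c * ∑ i ∈ Finset.range (K - J), (((5 * F.L : ℕ) : ℝ) ^ 2 / 4) * θ (K - i)) * (((F.L : ℝ)⁻¹) ^ (K - J) * ∑ ℓ : PBond (F.P K) 0, ‖ζ ℓ‖ ^ 2 +
                  (F.L : ℝ) ^ (K - J) * ∑ p : Plaq (F.P K) 0,
                    (1 - reTr ((GaugeField.plaqHol U₀ p)⁻¹ * GaugeField.plaqHol (fun ℓ => expPoint (ζ ℓ) * U₀ ℓ : GaugeField (F.P K) 0 (Matrix.specialUnitaryGroup (Fin 2) ℂ)) p)))) :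
    ∀ (L : ℕ), ∃ c₀ : ℝ, 0 < c₀ ∧ c₀ ≤ 1 ∧ ∀ (cw : ℝ), 0 < cw → cw ≤ c₀ → ∃ pS : ℝ, ∀ (b₀ p₀ : ℝ), 0 < b₀ → pS ≤ p₀ → 0 < p₀ → ∃ ε₁ : ℝ, 0 < ε₁ ∧ ∀ (ε₀ : ℝ), 0 < ε₀ → ε₀ ≤ ε₁ →
    ∃ γ₁ : ℝ, 0 < γ₁ ∧ ∃ C_T : ℝ, 0 ≤ C_T ∧ ∀ (F : T3Family) (γ : ℝ), F.L = L → 0 < γ → γ ≤ γ₁ →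
      ∀ (J K : ℕ) (hJK : J ≤ K) (V : GaugeField (F.P J) 0 (Matrix.specialUnitaryGroup (Fin 2) ℂ)), PlaqSmall (θBal F.L γ (cw * b₀) p₀ J) V →
        G F J V →
        ∀ U₀ ∈ {U' : GaugeField (F.P K) 0 (Matrix.specialUnitaryGroup (Fin 2) ℂ) | U' ∈ fibre F ℰp J K hJK V ∧ U' ∈ histGood F ℰp (θBal F.L γ b₀ p₀) K J ∧
            wilsonAction4 U' = minActionRegPr F J K hJK ε₀ V},
        ∀ ζ : PBond (F.P K) 0 → EuclideanSpace ℝ (Fin 3), (∀ ℓ, ‖ζ ℓ‖ ≤ Real.pi) →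
          (fun ℓ => expPoint (ζ ℓ) * U₀ ℓ : GaugeField (F.P K) 0 (Matrix.specialUnitaryGroup (Fin 2) ℂ)) ∈ histGood F ℰp (θBal F.L γ b₀ p₀) K J →
          descendTo F ℰp J K hJK (fun ℓ => expPoint (ζ ℓ) * U₀ ℓ : GaugeField (F.P K) 0 (Matrix.specialUnitaryGroup (Fin 2) ℂ)) = descendTo F ℰp J K hJK U₀ →
            Ax F J K hJK (fun ℓ => expPoint (ζ ℓ) * U₀ ℓ) U₀ →
            ∑ B : PBond (F.P J) 0, ‖imVec (su2Quat (descendTo F ℰp J K hJK (fun ℓ => expPoint (ζ ℓ) * U₀ ℓ) B * (descendTo F ℰp J K hJK U₀ B)⁻¹)) -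
                (fderiv ℝ (fun (ζ : PBond (F.P K) 0 → EuclideanSpace ℝ (Fin 3)) (B : PBond (F.P J) 0) =>
                  imVec (su2Quat (descendTo F ℰp J K hJK (fun ℓ => expPoint (ζ ℓ) * U₀ ℓ) B * (descendTo F ℰp J K hJK U₀ B)⁻¹))) 0)
                  (fun ℓ => Real.sinc ‖ζ ℓ‖ • ζ ℓ) B‖ ≤
              C_T * (((F.L : ℝ)⁻¹) ^ (K - J) * ∑ ℓ : PBond (F.P K) 0, ‖ζ ℓ‖ ^ 2 +
                (F.L : ℝ) ^ (K - J) * ∑ p : Plaq (F.P K) 0,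
                  (1 - reTr ((GaugeField.plaqHol U₀ p)⁻¹ * GaugeField.plaqHol (fun ℓ => expPoint (ζ ℓ) * U₀ ℓ : GaugeField (F.P K) 0 (Matrix.specialUnitaryGroup (Fin 2) ℂ)) p))) := by
  intro L
  obtain ⟨c₀B, hc₀B, hc₀B1, HB1⟩ := hBkgT L
  refine ⟨c₀B, hc₀B, hc₀B1, fun cw hcw hcwle => ?_⟩
  obtain ⟨pSB, HB2⟩ := HB1 cw hcw hcwle
  refine ⟨pSB, fun b₀ p₀ hb hpS hp => ?_⟩
  obtain ⟨ε₁B, hε₁B, HB3⟩ := HB2 b₀ p₀ hb hpS hp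
  refine ⟨ε₁B, hε₁B, fun ε₀ hε₀ hε₀le => ?_⟩
  obtain ⟨γB, hγB, C₁, hC₁, HB⟩ := HB3 ε₀ hε₀ hε₀le
  by_cases hL : 1 < L
  swap
  · refine ⟨1, one_pos, 0, le_rfl, fun F γ hFL => ?_⟩
    exact absurd (hFL ▸ F.hL.2) hL
  -- LOC″ with `C_B := C₁`
  obtain ⟨α₀, hα₀, C_T, hCT, c, hc, HL⟩ := hLoc''' L hL C₁ hC₁
  obtain ⟨γN, hγN, α, HN⟩ := prefixNumerics (L := L) hL (a₁ := 1) (B₃ := 1) (ε₀ := 1) one_pos one_pos one_pos hb p₀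
  set q : ℝ := (((5 * L : ℕ) : ℝ) ^ 2 / 4) with hq
  have hq0 : 0 < q := by rw [hq]; positivity
  have hq1 : 1 ≤ q := by
    rw [hq]
    have hL1 : (1 : ℝ) ≤ L := by exact_mod_cast hL.le
    have : (5 : ℝ) ≤ ((5 * L : ℕ) : ℝ) := by push_cast; nlinarith
    nlinarith
  obtain ⟨γS, hγS, HS⟩ := thresholdSum_small L hL b₀ p₀ hb hp q 1 1 hq0.le one_pos one_pos
  -- the extra window `α ≤ α₀`: shrink `γ` until `q·θBal ≤ α₀`
  obtain ⟨γA, hγA, HA⟩ := exists_forall_θBal_le hL.le b₀ p₀ (div_pos hα₀ hq0)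
  refine ⟨min (min γN γS) (min γA γB), lt_min (lt_min hγN hγS) (lt_min hγA hγB), C_T * Real.exp c, by positivity, ?_⟩
  intro F γ hFL hγ hγle J K hJK V hV hG U₀ hU₀ ζ hζπ hζg hFib hAx
  have hγN' : γ ≤ γN := hγle.trans ((min_le_left _ _).trans (min_le_left _ _))
  have hγS' : γ ≤ γS := hγle.trans ((min_le_left _ _).trans (min_le_right _ _))
  have hγA' : γ ≤ γA := hγle.trans ((min_le_right _ _).trans (min_le_left _ _))
  have hγB' : γ ≤ γB := hγle.trans ((min_le_right _ _).trans (min_le_right _ _))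
  obtain ⟨hθpos, -, -, -, hθα, hα24, hαδ, hαL⟩ := HN F γ hFL hγ hγN'
  obtain ⟨-, hsum⟩ := HS γ hγ hγS'
  have hθ0 : ∀ i, 0 ≤ θBal F.L γ b₀ p₀ i := fun i => (hθpos i).le
  -- the smaller window `α' := min α α₀`
  set α' : ℝ := min α α₀ with hα'
  have hθα' : ∀ i, J < i → i ≤ K → (((5 * F.L : ℕ) : ℝ) ^ 2 / 4) * θBal F.L γ b₀ p₀ i ≤ α' := by
    intro i _ _
    refine le_min (hθα i) ?_
    have h1 := HA γ hγ hγA' i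
    rw [hFL]
    calc (((5 * L : ℕ) : ℝ) ^ 2 / 4) * θBal L γ b₀ p₀ i = q * θBal L γ b₀ p₀ i := by rw [hq]
      _ ≤ q * (α₀ / q) := mul_le_mul_of_nonneg_left h1 hq0.le
      _ = α₀ := mul_div_cancel₀ α₀ hq0.ne'
  have hα24' : α' ≤ 1 / 24 := (min_le_left _ _).trans hα24
  have hαδ' : α' < deltaSU (Fin 2) := lt_of_le_of_lt (min_le_left _ _) hαδ
  have hαL' : 157 * α' < ((F.L : ℝ) ^ 2)⁻¹ := lt_of_le_of_lt (by have := min_le_left α α₀; nlinarith) hαL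
  have hαα₀ : α' ≤ α₀ := min_le_right _ _
  -- `θBal J ≤ α'` (the guard holds at EVERY `i`, and `q ≥ 1`)
  have hθJ : θBal F.L γ b₀ p₀ J ≤ α' := by
    have hqθ : q * θBal F.L γ b₀ p₀ J ≤ α' := by
      refine le_min ?_ ?_
      · have := hθα J; rw [hFL] at this ⊢; simpa only [hq] using this
      · have h1 := HA γ hγ hγA' J
        rw [hFL]
        calc q * θBal L γ b₀ p₀ J ≤ q * (α₀ / q) := mul_le_mul_of_nonneg_left h1 hq0.le
          _ = α₀ := mul_div_cancel₀ α₀ hq0.ne'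
    have hθJ0 := hθ0 J
    nlinarith
  -- the (BKG) binder at the argmin
  have hBKG : ∀ t, t ≤ K - J → ∀ p : Plaq (F.P K) t,
      dist1 (GaugeField.plaqHol (Averaging.iter (fun k => BlockAveraging.blockAvg (P := F.P K) (j := k) ℰp) t U₀) p) ≤
        C₁ * α' * (F.L : ℝ) ^ (2 * t) * ((F.L : ℝ)⁻¹) ^ (2 * (K - J)) := by
    intro t ht p
    have h := HB F γ hFL hγ hγB' J K hJK V hV hG U₀ hU₀ t ht p
    refine h.trans ?_
    have hpos : 0 ≤ (F.L : ℝ) ^ (2 * t) * ((F.L : ℝ)⁻¹) ^ (2 * (K - J)) := by positivity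
    calc C₁ * θBal F.L γ b₀ p₀ J * (F.L : ℝ) ^ (2 * t) * ((F.L : ℝ)⁻¹) ^ (2 * (K - J))
        = C₁ * θBal F.L γ b₀ p₀ J * ((F.L : ℝ) ^ (2 * t) * ((F.L : ℝ)⁻¹) ^ (2 * (K - J))) := by ring
      _ ≤ C₁ * α' * ((F.L : ℝ) ^ (2 * t) * ((F.L : ℝ)⁻¹) ^ (2 * (K - J))) :=
          mul_le_mul_of_nonneg_right (mul_le_mul_of_nonneg_left hθJ hC₁) hpos
      _ = _ := by ring
  have hGU₀ : G F J (descendTo F ℰp J K hJK U₀) := by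
    rw [show descendTo F ℰp J K hJK U₀ = V from hU₀.1]; exact hG
  have hloc := HL F hFL J K hJK (θBal F.L γ b₀ p₀) hθ0 α' hθα' hα24' hαδ' hαL' hαα₀ U₀ hU₀.2.1 hGU₀ hBKG ζ hζπ hζg hFib hAx
  refine hloc.trans ?_
  have hsum1 : ∑ i ∈ Finset.range (K - J), (((5 * F.L : ℕ) : ℝ) ^ 2 / 4) * θBal F.L γ b₀ p₀ (K - i) ≤ 1 := by
    have h := hsum J K hJK
    rw [← Finset.mul_sum]
    rw [hFL]; exact (by simpa only [hq, one_mul] using h)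
  have hexp : Real.exp (c * ∑ i ∈ Finset.range (K - J), (((5 * F.L : ℕ) : ℝ) ^ 2 / 4) * θBal F.L γ b₀ p₀ (K - i)) ≤ Real.exp c := by
    refine Real.exp_le_exp.2 ?_
    calc c * _ ≤ c * 1 := mul_le_mul_of_nonneg_left hsum1 hc
      _ = c := mul_one c
  have hR : 0 ≤ (((F.L : ℝ)⁻¹) ^ (K - J) * ∑ ℓ : PBond (F.P K) 0, ‖ζ ℓ‖ ^ 2 +
                (F.L : ℝ) ^ (K - J) * ∑ p : Plaq (F.P K) 0,
                  (1 - reTr ((GaugeField.plaqHol U₀ p)⁻¹ * GaugeField.plaqHol (fun ℓ => expPoint (ζ ℓ) * U₀ ℓ : GaugeField (F.P K) 0 (Matrix.specialUnitaryGroup (Fin 2) ℂ)) p))) := by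
    refine add_nonneg (by positivity) (mul_nonneg (by positivity) (Finset.sum_nonneg fun p _ => ?_))
    have := GaugeGroup.reTr_le_one ((GaugeField.plaqHol U₀ p)⁻¹ *
      GaugeField.plaqHol (fun ℓ => expPoint (ζ ℓ) * U₀ ℓ : GaugeField (F.P K) 0 (Matrix.specialUnitaryGroup (Fin 2) ℂ)) p)
    linarith
  calc C_T * Real.exp (c * ∑ i ∈ Finset.range (K - J), (((5 * F.L : ℕ) : ℝ) ^ 2 / 4) * θBal F.L γ b₀ p₀ (K - i)) * (((F.L : ℝ)⁻¹) ^ (K - J) * ∑ ℓ : PBond (F.P K) 0, ‖ζ ℓ‖ ^ 2 +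
                (F.L : ℝ) ^ (K - J) * ∑ p : Plaq (F.P K) 0,
                  (1 - reTr ((GaugeField.plaqHol U₀ p)⁻¹ * GaugeField.plaqHol (fun ℓ => expPoint (ζ ℓ) * U₀ ℓ : GaugeField (F.P K) 0 (Matrix.specialUnitaryGroup (Fin 2) ℂ)) p)))
      ≤ C_T * Real.exp c * (((F.L : ℝ)⁻¹) ^ (K - J) * ∑ ℓ : PBond (F.P K) 0, ‖ζ ℓ‖ ^ 2 +
                (F.L : ℝ) ^ (K - J) * ∑ p : Plaq (F.P K) 0,
                  (1 - reTr ((GaugeField.plaqHol U₀ p)⁻¹ * GaugeField.plaqHol (fun ℓ => expPoint (ζ ℓ) * U₀ ℓ : GaugeField (F.P K) 0 (Matrix.specialUnitaryGroup (Fin 2) ℂ)) p))) := by gcongr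


/-- ★★★ **AVG₂♭-ax_q (✓p825995's `hM`, VERBATIM) FROM LOC‴ AND THE (BKG) TOWER LETTER** (`avg2_of_taylor'''` ∘ `taylor_of_local'''`).
[cite: Balaban1985Averaging, Prop. 3 (123) p.36, (148)-(149) p.40; Balaban1985Variational, (R1); Balaban1985UV3, (7) p.257] -/
theorem avg2_of_local'''
    (G : (F : T3Family) → (J : ℕ) → GaugeField (F.P J) 0 (Matrix.specialUnitaryGroup (Fin 2) ℂ) → Prop)
    (Ax : (F : T3Family) → (J K : ℕ) → (hJK : J ≤ K) → GaugeField (F.P K) 0 (Matrix.specialUnitaryGroup (Fin 2) ℂ) →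
      GaugeField (F.P K) 0 (Matrix.specialUnitaryGroup (Fin 2) ℂ) → Prop)
    (hBkgT : ∀ (L : ℕ), ∃ c₀ : ℝ, 0 < c₀ ∧ c₀ ≤ 1 ∧ ∀ (cw : ℝ), 0 < cw → cw ≤ c₀ → ∃ pS : ℝ, ∀ (b₀ p₀ : ℝ), 0 < b₀ → pS ≤ p₀ → 0 < p₀ → ∃ ε₁ : ℝ, 0 < ε₁ ∧ ∀ (ε₀ : ℝ), 0 < ε₀ → ε₀ ≤ ε₁ →
      ∃ γ₁ : ℝ, 0 < γ₁ ∧ ∃ C₁ : ℝ, 0 ≤ C₁ ∧ ∀ (F : T3Family) (γ : ℝ), F.L = L → 0 < γ → γ ≤ γ₁ →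
        ∀ (J K : ℕ) (hJK : J ≤ K) (V : GaugeField (F.P J) 0 (Matrix.specialUnitaryGroup (Fin 2) ℂ)), PlaqSmall (θBal F.L γ (cw * b₀) p₀ J) V →
          G F J V →
          ∀ U₀ ∈ {U' : GaugeField (F.P K) 0 (Matrix.specialUnitaryGroup (Fin 2) ℂ) | U' ∈ fibre F ℰp J K hJK V ∧ U' ∈ histGood F ℰp (θBal F.L γ b₀ p₀) K J ∧
              wilsonAction4 U' = minActionRegPr F J K hJK ε₀ V},
          ∀ t, t ≤ K - J → ∀ p : Plaq (F.P K) t,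
            dist1 (GaugeField.plaqHol (Averaging.iter (fun k => BlockAveraging.blockAvg (P := F.P K) (j := k) ℰp) t U₀) p) ≤
              C₁ * θBal F.L γ b₀ p₀ J * (F.L : ℝ) ^ (2 * t) * ((F.L : ℝ)⁻¹) ^ (2 * (K - J)))
    (hLoc''' : ∀ (L : ℕ), 1 < L → ∀ (C_B : ℝ), 0 ≤ C_B → ∃ α₀ : ℝ, 0 < α₀ ∧ ∃ C_T : ℝ, 0 ≤ C_T ∧ ∃ c : ℝ, 0 ≤ c ∧ ∀ (F : T3Family), F.L = L →
        ∀ (J K : ℕ) (hJK : J ≤ K) (θ : ℕ → ℝ), (∀ i, 0 ≤ θ i) → ∀ (α : ℝ), (∀ i, J < i → i ≤ K → (((5 * F.L : ℕ) : ℝ) ^ 2 / 4) * θ i ≤ α) →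
          α ≤ 1 / 24 → α < deltaSU (Fin 2) → 157 * α < ((F.L : ℝ) ^ 2)⁻¹ → α ≤ α₀ →
          ∀ U₀ : GaugeField (F.P K) 0 (Matrix.specialUnitaryGroup (Fin 2) ℂ), U₀ ∈ histGood F ℰp θ K J →
          G F J (descendTo F ℰp J K hJK U₀) →
          (∀ t, t ≤ K - J → ∀ p : Plaq (F.P K) t,
              dist1 (GaugeField.plaqHol (Averaging.iter (fun k => BlockAveraging.blockAvg (P := F.P K) (j := k) ℰp) t U₀) p) ≤
                C_B * α * (F.L : ℝ) ^ (2 * t) * ((F.L : ℝ)⁻¹) ^ (2 * (K - J))) →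
          ∀ ζ : PBond (F.P K) 0 → EuclideanSpace ℝ (Fin 3), (∀ ℓ, ‖ζ ℓ‖ ≤ Real.pi) →
            (fun ℓ => expPoint (ζ ℓ) * U₀ ℓ : GaugeField (F.P K) 0 (Matrix.specialUnitaryGroup (Fin 2) ℂ)) ∈ histGood F ℰp θ K J →
            descendTo F ℰp J K hJK (fun ℓ => expPoint (ζ ℓ) * U₀ ℓ : GaugeField (F.P K) 0 (Matrix.specialUnitaryGroup (Fin 2) ℂ)) = descendTo F ℰp J K hJK U₀ →
              Ax F J K hJK (fun ℓ => expPoint (ζ ℓ) * U₀ ℓ) U₀ →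
              ∑ B : PBond (F.P J) 0, ‖imVec (su2Quat (descendTo F ℰp J K hJK (fun ℓ => expPoint (ζ ℓ) * U₀ ℓ) B * (descendTo F ℰp J K hJK U₀ B)⁻¹)) -
                  (fderiv ℝ (fun (ζ : PBond (F.P K) 0 → EuclideanSpace ℝ (Fin 3)) (B : PBond (F.P J) 0) =>
                    imVec (su2Quat (descendTo F ℰp J K hJK (fun ℓ => expPoint (ζ ℓ) * U₀ ℓ) B * (descendTo F ℰp J K hJK U₀ B)⁻¹))) 0)
                    (fun ℓ => Real.sinc ‖ζ ℓ‖ • ζ ℓ) B‖ ≤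
                C_T * Real.exp (c * ∑ i ∈ Finset.range (K - J), (((5 * F.L : ℕ) : ℝ) ^ 2 / 4) * θ (K - i)) * (((F.L : ℝ)⁻¹) ^ (K - J) * ∑ ℓ : PBond (F.P K) 0, ‖ζ ℓ‖ ^ 2 +
                  (F.L : ℝ) ^ (K - J) * ∑ p : Plaq (F.P K) 0,
                    (1 - reTr ((GaugeField.plaqHol U₀ p)⁻¹ * GaugeField.plaqHol (fun ℓ => expPoint (ζ ℓ) * U₀ ℓ : GaugeField (F.P K) 0 (Matrix.specialUnitaryGroup (Fin 2) ℂ)) p)))) :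
    ∀ (L : ℕ), ∃ c₀ : ℝ, 0 < c₀ ∧ c₀ ≤ 1 ∧ ∀ (cw : ℝ), 0 < cw → cw ≤ c₀ → ∃ pS : ℝ, ∀ (b₀ p₀ : ℝ), 0 < b₀ → pS ≤ p₀ → 0 < p₀ → ∃ ε₁ : ℝ, 0 < ε₁ ∧ ∀ (ε₀ : ℝ), 0 < ε₀ → ε₀ ≤ ε₁ →
    ∃ γ₁ : ℝ, 0 < γ₁ ∧ ∃ C_M : ℝ, 0 ≤ C_M ∧ ∀ (F : T3Family) (γ : ℝ), F.L = L → 0 < γ → γ ≤ γ₁ →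
      ∀ (J K : ℕ) (hJK : J ≤ K) (V : GaugeField (F.P J) 0 (Matrix.specialUnitaryGroup (Fin 2) ℂ)), PlaqSmall (θBal F.L γ (cw * b₀) p₀ J) V →
        G F J V →
        ∀ U₀ ∈ {U' : GaugeField (F.P K) 0 (Matrix.specialUnitaryGroup (Fin 2) ℂ) | U' ∈ fibre F ℰp J K hJK V ∧ U' ∈ histGood F ℰp (θBal F.L γ b₀ p₀) K J ∧
            wilsonAction4 U' = minActionRegPr F J K hJK ε₀ V},
        ∀ U ∈ fibre F ℰp J K hJK V, U ∈ histGood F ℰp (θBal F.L γ b₀ p₀) K J →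
            Ax F J K hJK U U₀ →
            ∑ B : PBond (F.P J) 0, ‖(fderiv ℝ (fun (ζ : PBond (F.P K) 0 → EuclideanSpace ℝ (Fin 3)) (B : PBond (F.P J) 0) =>
            imVec (su2Quat (descendTo F ℰp J K hJK (fun ℓ => expPoint (ζ ℓ) * U₀ ℓ) B * (descendTo F ℰp J K hJK U₀ B)⁻¹))) 0) (fun ℓ => imVec (su2Quat (U ℓ * (U₀ ℓ)⁻¹))) B‖ ≤
              C_M * (((F.L : ℝ)⁻¹) ^ (K - J) * ∑ ℓ : PBond (F.P K) 0, dist1 (U ℓ * (U₀ ℓ)⁻¹) ^ 2 +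
                (F.L : ℝ) ^ (K - J) * ∑ p : Plaq (F.P K) 0, (1 - reTr ((GaugeField.plaqHol U₀ p)⁻¹ * GaugeField.plaqHol U p))) :=
  avg2_of_taylor''' G Ax (taylor_of_local''' G Ax hBkgT hLoc''')

end Summit.QuantumFields.YangMills.Theorems.FluctuationComparisonRegPrIntLS2BetaTaylorOfLocalFib

end
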